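import Literature.MathematicalPhysics.QuantumFieldTheory.Balaban1983to89.B9Ineq386RightEntry
import Literature.MathematicalPhysics.QuantumFieldTheory.Balaban1983to89.B9Cor35GAtCubeLetters

/-!
# `Balaban1983to89.B9Ineq386RightEntryDirs` — [B9] p. 407 (3.86) ⇒ (3.42)₃ for `G(U′U)`, the RIGHT entry `G(U′U)∇*_U`, with the remainder `V(A)` read in
# DIVERGENCE FORM OVER A FINITE FAMILY OF DIFFERENCE LETTERS `V = Σ_k ∇♯_k·B_k + C` — the multi-letter twin of r06's `B9Ineq386RightEntry` §3–§4 (as p38's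
# `B9Cor35GAtCubeLetters.ineq385_op_dirs` is the multi-letter twin of `B9Ineq385VG.ineq385_op` for the left entries); letter-free, [4]'s majorant calculus only
# (sub-row G-B9-LETTERS, module M5.1b-G, programme RIGHT-ENTRY-V = cell GAPS G-B9-02 entry n = 2 at `Ṽ_□`, FILE F-D)

statement-level skeleton of published theorems with citation tags; proofs where landed; nothing here is a claim about the Yang–Mills mass gap

Sources under audit (cell lit-balaban): T. Bałaban, *Propagators for lattice gauge theories in a background field*, Commun. Math. Phys. **99** (1985) 389–434
[`Balaban1985BackgroundPropagators`, "B9"], (3.84)–(3.86) p. 407, Thm 3.3 p. 399, (3.42) p. 397, p. 398 l. 20–24 (remarks after Thm 3.1), (3.70)–(3.73)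
pp. 404–405; [4] = T. Bałaban, *Propagators and renormalization transformations for lattice gauge theories. II*, Commun. Math. Phys. **96** (1984) 223–250
[`Balaban1984PropagatorsII`], (2.51)–(2.55) p. 232, Lemma 2.1 ∕ (2.61) ∕ (2.66) p. 234.  Unit `lit-balaban-p33` (p33 gen 102); B9 fold owner r06; referee ref-4.

## WHAT IS PRINTED (verbatim up to notation)

p. 407: «and we have G(U′U) = G(U)(I − V(A)G(U))⁻¹ = Σ_{n=0}^∞ G(U)(V(A)G(U))ⁿ, (3.86) … Theorem (3.3) implies also convergence in all norms appearing in its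
formulation, thus in all norms on the left-hand sides of the inequalities (3.42)–(3.47). This way we get all these inequalities for the operator G(U′U)»;
p. 397 (3.42): «|(G′(U)λ)(x)|, |(∇_UG′(U)λ)(x)|, |(G′(U)∇*_Uλ)(x)|, |(Δ_UG′(U)λ)(x)| ≦ B₀[(Lʲη)², Lʲη, Lʲη, 1]e^{−δ₀d(y,y′)}|λ|»; p. 398 l. 20–22: «At first the
choice of derivatives ∇_U, ∇*_U is conventional, we may always replace ∇_U by ∇*_U, and vice versa, in arbitrary place and combination.»; p. 405 (3.73):
«|(V₁(A)A′)(b)| ≦ O(1)(|∇A||A′| + |A|²|A′|) + O(1)|A|(|∇_UA′| + …) ≦ O(1)α₁((Lʲη)⁻¹|∇_UA′| + (Lʲη)⁻²|A′|)».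

## WHY THIS FILE

r06's `B9Ineq386RightEntry.gExt_rightEntry_of_386L` turns the LEFT resolvent form of (3.86), `G(U′U) = G(U) + G(U)V(A)G(U′U)`, multiplied on the right by `∇*`, into
the right entry (3.42)₃ for `G(U′U)`, given (3.42)₃ for `G(U)` and a majorant of the left composite `G(U)V(A) ≺ θe^{−ρd}`; its §3 `hasMajorant_GV_of_divForm`
derives that composite from a divergence-form reading `V₃ = ∇♯·B₃ + C₃` with ONE difference letter `∇♯`.  At def-Y's cube letters (p38's module M5.1b-G) the
remainder `V = Δ_{a,□}(1) − Δ_{a,□}(Ṽ_□)` in divergence form carries one letter per lattice direction — `V = Σ_μ ∇*_μ·U¹_μ + U⁰` (files F-A∕F-B∕F-C of this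
programme) — exactly as p38's gradient form `V⁰ + Σ_μ V¹_μ∇_μ` did on the left side, where p38 wrote the multi-letter twin `ineq385_op_dirs` of r06's
`ineq385_op`.  THIS FILE is the corresponding multi-letter twin on the RIGHT side: §1 the left composite `G·V ≺ κ_R·α₁·e^{−ρd}` from `V = Σ_k ∇♯_k·B_k + C`, the
right entries `G·∇♯_k ≺ B₀(Lʲη)e^{−δd}` (one per letter), `B_k ≺ c_Bα₁(Lʲη)⁻¹e^{−δd}`, `C ≺ c_Cα₁(Lʲη)⁻²e^{−δd}`, `G ≺ B₀(Lʲη)²e^{−δd}`; §2 the right entry (3.42)₃ of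
`G(U′U)` for one more letter `∇*` from §1 and r06's §2, with the located smallness `κ_Rα₁c₁(α′) < 1`.

## WHAT THIS FILE CERTIFIES (kernel-checked; THEOREMS ONLY — the constant `κ_R = B₀Λc(m·c_B + c_C)` is spelled out; 0 `def`, 0 `def … : Prop`, 0 sorry; standard axioms)

* §1 ★★ `hasMajorant_GV_of_divForm_dirs` — for `ρ ≥ 0`, `ρ + (α+β)δ₀ ≤ δ`:
  `G·(Σ_k ∇♯_k B_k + C) ≺ B₀Λc₁(β)(|κ|·c_B + c_C) · α₁ · e^{−ρd}` (the `|κ| + 1` words `(G∇♯_k)B_k`, `GC`, one composition each, [4] (2.52)–(2.55) + Lemma 2.1).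
* §2 ★★★ `gExt_rightEntry_of_386L_divForm_dirs` — from §1's hypotheses, (3.42)₃ for `G(U)` and the letter `∇*` (`G∇* ≺ B₀(Lʲη)e^{−δd}`), the left resolvent
  identity `G(U′U) = G(U) + G(U)·V·G(U′U)`, [4] (2.61) at `(ρ, α′)`, the p. 398 convention at `(ρ, α′)` with constant `Λ_ρ`, the symmetry of `d` and
  `κ_Rα₁c₁(α′) < 1`: `G(U′U)∇* ≺ B₀Λ_ρ²c₁(α′)(1 − κ_Rα₁c₁(α′))⁻¹·(Lʲη)·e^{−(1−3α′)ρd}` (r06's `gExt_rightEntry_of_386L`).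

## HONEST SCOPE

Operator (block `L^∞ → L^∞`) form throughout, as in r06's files (i); THE DIVERGENCE FORM IS A HYPOTHESIS (`hV`), identified on def-Y's cube carrier by files
F-A∕F-B∕F-C of this programme, not here; rates and weights as in r06's §2–§4 (loses `3α′ρ` in the output-weight form); nothing about a concrete `V`, `G`, `∇♯` is
asserted; NOT here: Hölder ∕ `L²` ∕ global entries, analyticity.  Count-neutral; NOT a node discharge; no summit ∕ sub-problem statement is proved; nothing
continuum ∕ OS ∕ mass-gap ∕ Clay; YM mass gap NOT proved by any of this (Track A conditional rung).  No `sorry`, no `axiom`, no `… : Prop` fact, no `instance`, no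
`notation`.  NEW file; nothing landed is modified.  `--supports stmt-QuantumFields-19200` as helper.  Net new unproved facts: 0.

RELATED IN THE TREE, NOT DUPLICATED (searched 2026-08-28: `rg 'divForm_dirs|RightEntryDirs'` over `Literature/` = ∅): r06 `B9Ineq386RightEntry`
(one letter; USED BY NAME in §2), p38 `B9Cor35GAtCubeLetters.ineq385_op_dirs` ∕ `hasMajorant_fsum` (left side; `hasMajorant_fsum` USED BY NAME), r06
`B9Ineq366CPrime.hasMajorant_comp_decay` ∕ `hasMajorant_rate_mono` (the composition rule; USED BY NAME).
-/

noncomputable section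

namespace Literature.MathematicalPhysics.QuantumFieldTheory.Balaban1983to89.B9Ineq386RightEntryDirs

open Literature.MathematicalPhysics.QuantumFieldTheory.Balaban1983to89
open Literature.MathematicalPhysics.QuantumFieldTheory.Balaban1983to89.B6RandomWalk (HasMajorant hasMajorant_mono hasMajorant_add Triangle254 Ineq261 c1_nonneg)
open Literature.MathematicalPhysics.QuantumFieldTheory.Balaban1983to89.B9Thm34Ext (toB6)
open Literature.MathematicalPhysics.QuantumFieldTheory.Balaban1983to89.B9Ineq347 (ScaleTransfer)
open Literature.MathematicalPhysics.QuantumFieldTheory.Balaban1983to89.B9Ineq366CPrime (hasMajorant_comp_decay hasMajorant_rate_mono)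
open Literature.MathematicalPhysics.QuantumFieldTheory.Balaban1983to89.B9Ineq386RightEntry (gExt_rightEntry_of_386L)
open Literature.MathematicalPhysics.QuantumFieldTheory.Balaban1983to89.B9Cor35GAtCubeLetters (hasMajorant_fsum)

/-! ## §1  The left composite `G·V` from a divergence form with a finite family of difference letters -/

section LeftComposite

variable {g : B9.Geometry} [Fintype g.Site] {R : ℝ} {H : Prop} {W : Type}

/-- ★★ **`G(U)V(A) ≺ κ_R·α₁·e^{−ρd}` FROM A DIVERGENCE FORM WITH A FINITE FAMILY OF DIFFERENCE LETTERS** — the mirror image of (3.85) («|(V(A)G(U)J)(b)| ≦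
O(1)α₁e^{−(1∕2)δ₀d(y,y′)}|J|») for the composite that the RIGHT entry of (3.86) needs.  LETTERS: `V = Σ_k ∇♯_k·B_k + C` (`hV`; the first-order part with its
difference letters `∇♯_k` ON THE LEFT of the coefficients — print's (3.70)–(3.73) read from the input side under the p. 398 licence «we may always replace ∇_U by
∇*_U, and vice versa, in arbitrary place and combination»), coefficients of the (3.73) sizes `B_k ≺ c_Bα₁(Lʲη)⁻¹e^{−δd}`, `C ≺ c_Cα₁(Lʲη)⁻²e^{−δd}`; Theorem 3.3 for
`G(U)`: (3.42)₁ `G ≺ B₀(Lʲη)²e^{−δd}` and the right entries (3.42)₃ `G∇♯_k ≺ B₀Lʲη e^{−δd}` (one per letter); the p. 398 scale transfers of `(Lʲη)⁻¹`, `(Lʲη)⁻²` at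
exponent `α` with constant `Λ ≥ 0`, [4] (2.61) at `β`, (2.54), `d ≥ 0`, `Lʲη > 0`.  CONCLUSION: for `ρ ≥ 0` with `ρ + (α+β)δ₀ ≤ δ`,
`G·V ≺ κ_R·α₁·e^{−ρd(y,y′)}`, `κ_R = B₀Λc₁(β)(|κ|·c_B + c_C)` — the `|κ| + 1` words `(G∇♯_k)B_k`, `GC`, one composition each ([4] (2.52)–(2.55)).
[cite: Balaban1985BackgroundPropagators, (3.84)–(3.86) p.407, (3.70)–(3.73) pp.404–405, Thm 3.3 p.399, (3.42) p.397, p.398 l.20–24; Balaban1984PropagatorsII, Lemma 2.1 p.234, (2.52)–(2.55) p.232] -/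
theorem hasMajorant_GV_of_divForm_dirs {κ : Type} [Fintype κ] (blk : W → g.Site) (d : ℕ) (δ₀ δ α β ρ Λ B₀ cB cC α₁ : ℝ)
    (hB₀ : 0 ≤ B₀) (hcB : 0 ≤ cB) (hcC : 0 ≤ cC) (hα₁ : 0 ≤ α₁) (hΛ : 0 ≤ Λ) (hρ : 0 ≤ ρ)
    (hα : 0 ≤ α) (hβ : 0 ≤ β) (hδ₀ : 0 ≤ δ₀) (hr : ρ + (α + β) * δ₀ ≤ δ)
    (hdnn : ∀ a b : g.Site, 0 ≤ g.dist a b) (htri : Triangle254 (toB6 g R H)) (hlen : ∀ y : g.Site, 0 < g.len y)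
    (h261 : Ineq261 d (toB6 g R H) δ₀ β)
    (hT1i : ScaleTransfer g δ₀ α Λ (fun a => (g.len a)⁻¹)) (hT2i : ScaleTransfer g δ₀ α Λ (fun a => (g.len a ^ 2)⁻¹))
    {G V C : Module.End ℝ (W → ℝ)} {Dv Bw : κ → Module.End ℝ (W → ℝ)} (hV : V = ∑ k, Dv k * Bw k + C)
    (hB : ∀ k, HasMajorant (g := toB6 g R H) blk (Bw k) (fun a b => cB * α₁ * (g.len a)⁻¹ * Real.exp (-(δ * g.dist a b))))
    (hC : HasMajorant (g := toB6 g R H) blk C (fun a b => cC * α₁ * (g.len a ^ 2)⁻¹ * Real.exp (-(δ * g.dist a b))))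
    (hG : HasMajorant (g := toB6 g R H) blk G (fun a b => B₀ * g.len a ^ 2 * Real.exp (-(δ * g.dist a b))))
    (hGDv : ∀ k, HasMajorant (g := toB6 g R H) blk (G * Dv k) (fun a b => B₀ * g.len a * Real.exp (-(δ * g.dist a b)))) :
    HasMajorant (g := toB6 g R H) blk (G * V)
      (fun a b => (B₀ * Λ * B6.c1 d δ₀ β * ((Fintype.card κ : ℝ) * cB + cC)) * α₁ * Real.exp (-(ρ * g.dist a b))) := by
  set c : ℝ := B6.c1 d δ₀ β with hc_def
  have hw1 : ∀ a : g.Site, 0 ≤ g.len a := fun a => (hlen a).le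
  have hw2 : ∀ a : g.Site, 0 ≤ g.len a ^ 2 := fun a => sq_nonneg _
  have hw1i : ∀ a : g.Site, 0 ≤ (g.len a)⁻¹ := fun a => inv_nonneg.mpr (hlen a).le
  have hw2i : ∀ a : g.Site, 0 ≤ (g.len a ^ 2)⁻¹ := fun a => inv_nonneg.mpr (sq_nonneg _)
  have hcBα : 0 ≤ cB * α₁ := mul_nonneg hcB hα₁
  have hcCα : 0 ≤ cC * α₁ := mul_nonneg hcC hα₁
  have hρδ : ρ ≤ δ := by
    have : 0 ≤ (α + β) * δ₀ := by positivity
    linarith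
  -- rate-weakened right letters
  have hBρ := fun k => hasMajorant_rate_mono (R := R) (H := H) blk (cB * α₁) (fun a => (g.len a)⁻¹) hcBα hw1i hρδ hdnn (hB k)
  have hCρ := hasMajorant_rate_mono (R := R) (H := H) blk (cC * α₁) (fun a => (g.len a ^ 2)⁻¹) hcCα hw2i hρδ hdnn hC
  -- the words `(G∇♯_k)·B_k` and `G·C`
  have w1 : ∀ k, HasMajorant (g := toB6 g R H) blk (G * Dv k * Bw k)
      (fun a b => (B₀ * (cB * α₁) * Λ * c) * (g.len a * (g.len a)⁻¹) * Real.exp (-(ρ * g.dist a b))) := fun k =>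
    hasMajorant_comp_decay (R := R) (H := H) blk d δ₀ α β ρ δ Λ B₀ (cB * α₁) (fun a => g.len a) (fun a => (g.len a)⁻¹)
      hw1 hw1i hΛ hB₀ hcBα hρ hr hdnn htri hT1i h261 (hGDv k) (hBρ k)
  have w2 := hasMajorant_comp_decay (R := R) (H := H) blk d δ₀ α β ρ δ Λ B₀ (cC * α₁) (fun a => g.len a ^ 2)
    (fun a => (g.len a ^ 2)⁻¹) hw2 hw2i hΛ hB₀ hcCα hρ hr hdnn htri hT2i h261 hG hCρ
  have wS := hasMajorant_fsum (R := R) (H := H) blk Finset.univ (fun k => G * Dv k * Bw k) _ (fun k _ => w1 k)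
  have hsum := hasMajorant_add (g := toB6 g R H) blk wS w2
  have e : G * V = ∑ k, G * Dv k * Bw k + G * C := by
    rw [hV, mul_add, Finset.mul_sum]
    simp only [mul_assoc]
  rw [e]
  refine hasMajorant_mono (g := toB6 g R H) blk hsum fun a b => le_of_eq ?_
  have ha : g.len a ≠ 0 := (hlen a).ne'
  simp only [Finset.sum_const, Finset.card_univ, nsmul_eq_mul]
  field_simp
  ring

end LeftComposite

/-! ## §2  (3.86), left resolvent form, times `∇*` on the right: the right entry (3.42)₃ for `G(U′U)` from the multi-letter divergence form -/

section Assembly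

variable {g : B9.Geometry} [Fintype g.Site] {R : ℝ} {H : Prop} {W : Type} [Fintype W] [DecidableEq W]

/-- ★★★ **(3.42)₃ FOR `G(U′U)` FROM THE MULTI-LETTER DIVERGENCE FORM AND THE LEFT RESOLVENT IDENTITY OF (3.86)** («This way we get all these inequalities for
the operator G(U′U)», the right sup-entry `G(U′U)∇*_U`): with the hypotheses of §1's `hasMajorant_GV_of_divForm_dirs` (⇒ `G(U)V(A) ≺ κ_Rα₁e^{−ρd}`), (3.42)₃
`G(U)∇* ≺ B₀Lʲη e^{−δd}` for `G(U)` and the letter `∇*` («we may always replace ∇_U by ∇*_U», p. 398), `G(U′U) = G(U) + G(U)V(A)G(U′U)` (`h386L`), [4] Lemma 2.1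
at `(ρ, α′)`, the convention at `(ρ, α′)` (constant `Λ_ρ`), the symmetry of `d` and the located smallness `κ_Rα₁c₁(α′) < 1`:
`G(U′U)∇* ≺ B₀Λ_ρ²c₁(α′)(1 − κ_Rα₁c₁(α′))⁻¹Lʲη e^{−(1−3α′)ρd}` — r06's `gExt_rightEntry_of_386L` fed by §1.
[cite: Balaban1985BackgroundPropagators, (3.84)–(3.86) p.407, Thm 3.3 p.399, (3.42) p.397, p.398 l.20–24; Balaban1984PropagatorsII, (2.66) p.234, Lemma 2.1 p.234] -/
theorem gExt_rightEntry_of_386L_divForm_dirs {κ : Type} [Fintype κ] (blk : W → g.Site) (d : ℕ) (δ₀ δ α β ρ α' Λ Λρ B₀ cB cC α₁ : ℝ)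
    (hB₀ : 0 ≤ B₀) (hcB : 0 ≤ cB) (hcC : 0 ≤ cC) (hα₁ : 0 ≤ α₁) (hΛ : 0 ≤ Λ) (hΛρ : 0 ≤ Λρ)
    (hρ : 0 ≤ ρ) (hα : 0 ≤ α) (hβ : 0 ≤ β) (hδ₀ : 0 ≤ δ₀) (hr : ρ + (α + β) * δ₀ ≤ δ) (hα' : α' ≤ 1)
    (hα'ρ : 0 ≤ α' * ρ) (hα'ρ2 : 0 ≤ (1 - 2 * α') * ρ)
    (hdnn : ∀ a b : g.Site, 0 ≤ g.dist a b) (htri : Triangle254 (toB6 g R H)) (hrefl : ∀ y : g.Site, g.dist y y = 0)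
    (hsym : ∀ y y' : g.Site, g.dist y y' = g.dist y' y) (hlen : ∀ y : g.Site, 0 < g.len y)
    (h261 : Ineq261 d (toB6 g R H) δ₀ β) (h261' : Ineq261 d (toB6 g R H) ρ α')
    (hT1i : ScaleTransfer g δ₀ α Λ (fun a => (g.len a)⁻¹)) (hT2i : ScaleTransfer g δ₀ α Λ (fun a => (g.len a ^ 2)⁻¹))
    (hTρ : ScaleTransfer g ρ α' Λρ (fun a => g.len a))
    (hsmall : (B₀ * Λ * B6.c1 d δ₀ β * ((Fintype.card κ : ℝ) * cB + cC)) * α₁ * B6.c1 d ρ α' < 1)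
    {G GExt V C Ds : Module.End ℝ (W → ℝ)} {Dv Bw : κ → Module.End ℝ (W → ℝ)} (hV : V = ∑ k, Dv k * Bw k + C)
    (hB : ∀ k, HasMajorant (g := toB6 g R H) blk (Bw k) (fun a b => cB * α₁ * (g.len a)⁻¹ * Real.exp (-(δ * g.dist a b))))
    (hC : HasMajorant (g := toB6 g R H) blk C (fun a b => cC * α₁ * (g.len a ^ 2)⁻¹ * Real.exp (-(δ * g.dist a b))))
    (hG : HasMajorant (g := toB6 g R H) blk G (fun a b => B₀ * g.len a ^ 2 * Real.exp (-(δ * g.dist a b))))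
    (hGDv : ∀ k, HasMajorant (g := toB6 g R H) blk (G * Dv k) (fun a b => B₀ * g.len a * Real.exp (-(δ * g.dist a b))))
    (hGDs : HasMajorant (g := toB6 g R H) blk (G * Ds) (fun a b => B₀ * g.len a * Real.exp (-(δ * g.dist a b))))
    (h386L : GExt = G + G * V * GExt) :
    HasMajorant (g := toB6 g R H) blk (GExt * Ds)
      (fun a b => B₀ * Λρ ^ 2 * B6.c1 d ρ α' * (1 - (B₀ * Λ * B6.c1 d δ₀ β * ((Fintype.card κ : ℝ) * cB + cC)) * α₁ * B6.c1 d ρ α')⁻¹ *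
        g.len a * Real.exp (-((1 - 3 * α') * ρ * g.dist a b))) := by
  have hGV := hasMajorant_GV_of_divForm_dirs (R := R) (H := H) blk d δ₀ δ α β ρ Λ B₀ cB cC α₁ hB₀ hcB hcC hα₁ hΛ hρ hα hβ hδ₀ hr hdnn htri hlen
    h261 hT1i hT2i hV hB hC hG hGDv
  have hρδ : ρ ≤ δ := by
    have : 0 ≤ (α + β) * δ₀ := by positivity
    linarith
  have hGDsρ := hasMajorant_rate_mono (R := R) (H := H) blk B₀ (fun a => g.len a) hB₀ (fun a => (hlen a).le) hρδ hdnn hGDs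
  have hc1 : 0 ≤ B6.c1 d δ₀ β := c1_nonneg d δ₀ β
  have hθ : 0 ≤ (B₀ * Λ * B6.c1 d δ₀ β * ((Fintype.card κ : ℝ) * cB + cC)) * α₁ := by positivity
  exact gExt_rightEntry_of_386L (R := R) (H := H) blk d ρ α' _ B₀ Λρ (fun a => g.len a) hB₀ hΛρ (fun a => (hlen a).le) hθ hρ hα' hα'ρ
    hα'ρ2 htri hrefl hsym hdnn h261' hsmall hTρ hGDsρ hGV h386L

end Assembly

end Literature.MathematicalPhysics.QuantumFieldTheory.Balaban1983to89.B9Ineq386RightEntryDirs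

end
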